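/-
Copyright (c) 2026 the pub-hodgecm-mathlib formalisation cell (harness21).  Prover seat hodgecm-mathlib-B-p14 (g36): road «S3-tree» (chair F0P3a-plan (g11); T10-42 (3) «S3-res =
ramified ∪ wild» capital), brick T1e «VALENCIES», DATUM-FREE EDITION R1 = the stars for ANY involution (tame ramified places included); 2026-09-01.  Twin of ★ `UnitaryLatticeTreeStar` (V1).
-/
import Literature.NumberTheory.Automorphic.UnitaryLatticeTreeStar                       -- ★ T1e V1 (B-p14 (g36)): the datum versions; `le_of_isSelfDualLattice_of_le`, `not_lt_of_isSelfDualLattice`, transport lemmas (already datum-free)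
import Literature.NumberTheory.Automorphic.UnitaryLatticeTreeSelfDualTransitiveOfTrace   -- ★ F0P3a-p07 (g11): `exists_unitary_mapGL_stdLattice_eq_of_isSelfDualLattice_of_trace` (self-dual transitivity, datum-free)
import HarnessLib

/-!
# The lattice graph of a hermitian space — T1e FILE R1: THE STARS OF THE `U(3)` LATTICE TREE FOR AN ARBITRARY INVOLUTION (no unramified datum: the TAME RAMIFIED case
# `σϖ = −ϖ` included): types alternate, the two stars as sets of lattices, transport to `L₀` and `N₁` (Bruhat–Tits 1972 §10; Tits 1979 §2.4, §3.5; Serre, *Trees* II.1.1)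

Topic `NumberTheory/Automorphic`; namespace `Literature.NumberTheory.Automorphic.UnitaryLatticeTree`.  THEOREMS ONLY (no definition, no instance, no notation, no named fact,
no `sorry`); kernel lane.  Cell `pub/hodgecm-mathlib` (D-0151), crux H413 = `stmt-HodgeConjecture-24833`; road «S3-tree», brick T1e «VALENCIES», DATUM-FREE EDITION (chair
T10-42 (3): the residue letter «S3-res = {v tame-ramified} ∪ {v ∣ 2}» is paid down by exactly such twins).  ★ V1 `UnitaryLatticeTreeStar` states the star structure under
`hd : UnramifiedLocalConjDatum σ ϖ` (which forces `σϖ = ϖ`); its proofs use the datum only through `|σ ·| = |·|` and `|ϖ| = exp(−1)`, and the two transports only through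
self-dual ∕ type-two TRANSITIVITY.  Here the same statements are given under `(hvσ) (hϖ)` alone, the self-dual transport through ★ F0P3a-p07 (g11)
`exists_unitary_mapGL_stdLattice_eq_of_isSelfDualLattice_of_trace` (`htrace : ∃ t, |t| ≤ 1 ∧ t + σt = 1` — `t = ½` at a tame place, the datum's trace at an unramified one), and the
type-two transport through a HYPOTHESIS `htr₂` (discharged by ★ `forall_isVertexLattice_two_exists_mapGL_N₁_eq` (unramified datum) or ★ p07
`forall_isVertexLattice_two_exists_mapGL_N₁_eq_of_neg` (tame ramified)), with the type of `N₁ = latt diag(1,1,ϖ)` as a hypothesis `hN₁` (★ `isVertexLattice_two_latt_diagonal_one_one`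
for `σϖ = ϖ`, ★ p07 `isVertexLattice_two_N₁_of_neg` for `σϖ = −ϖ`).  Sequel R2∕R3: the datum-free ∕ ramified COUNTS.

* §1 `isVertexLattice_two_and_isSelfDualLattice_of_lt_of_v`, `not_isSelfDualLattice_of_isVertexLattice_two_of_v`.
* §2 `latticeGraph_adj_iff_lt_of_isSelfDualLattice_of_v`, `latticeGraph_adj_iff_gt_of_isVertexLattice_two_of_v`, `neighborSet_eq_of_isSelfDualLattice_of_v`, `neighborSet_eq_of_isVertexLattice_two_of_v`,
  **`isSelfDualLattice_iff_not_isSelfDualLattice_of_adj_of_v`** (types alternate; the `hc` of the layer recursions).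
* §3 `isSelfDualLattice_stdLattice_three_of_v` (the root is self-dual, any `σ`), `exists_latticeGraphIso_root_eq_of_trace`, `exists_latticeGraphIso_N₁_eq_of_htr₂`,
  **`ncard_neighborSet_eq_ncard_neighborSet_root_of_trace`** ∕ `finite_neighborSet_iff_root_of_trace`, **`ncard_neighborSet_eq_ncard_neighborSet_N₁_of_htr₂`** ∕ `finite_neighborSet_iff_N₁_of_htr₂`,
  `mem_neighborSet_root_iff_of_v`, `mem_neighborSet_N₁_iff_of_v`.

HONEST LABEL: HC_CM is proved only modulo the 2 remaining named inputs (hLiu418 24832, h413 24833) until rung 0 closes; nothing printed is asserted here; S3 stays a print row until the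
road's END lands, and the ramified places belong to the residue letter S3-res.

## References
* [BruhatTits1972] F. Bruhat, J. Tits, *Groupes réductifs sur un corps local I*, Publ. Math. IHÉS 41 (1972), §10.
* [Tits1979] J. Tits, *Reductive groups over local fields*, PSPM 33.1 (1979), §2.4 (ramified `U(3)`: both vertex types special, local index `(q+1, q+1)`), §3.5.
* [Serre1980Trees] J.-P. Serre, *Trees* (1980), Ch. II §1.1.
* [Jacobowitz1962] R. Jacobowitz, *Hermitian forms over local fields*, Amer. J. Math. 84 (1962), §7–§8.
-/

set_option autoImplicit false

noncomputable section

open scoped Valued WithZero Matrix MatrixGroups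

namespace Literature.NumberTheory.Automorphic.UnitaryLatticeTree

open Literature.NumberTheory.Automorphic Literature.NumberTheory.Automorphic.HermitianLattice
open Literature.NumberTheory.Automorphic.CartanUnique

variable {K : Type*} [Field K] [Valued K ℤᵐ⁰] {σ : K →+* K} {ϖ : K}

/-! ## §1 Comparable vertices (any involution) -/

/-- **Of two comparable distinct vertices the smaller is of type `2` and the larger is self-dual** — `σ` valuation-preserving, `ϖ` a uniformiser, NO datum.
[cite: BruhatTits1972, §10] [cite: Serre1980Trees, II.1.1] -/
theorem isVertexLattice_two_and_isSelfDualLattice_of_lt_of_v (hvσ : ∀ a, Valued.v (σ a) = Valued.v a) (hϖ : Valued.v ϖ = WithZero.exp (-1 : ℤ))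
    {M M' : Submodule 𝒪[K] (Fin 3 → K)} (hM : IsVertex σ ϖ ((StdForm.antidiagonal 3).over K) M) (hM' : IsVertex σ ϖ ((StdForm.antidiagonal 3).over K) M') (h : M < M') :
    IsVertexLattice σ ϖ ((StdForm.antidiagonal 3).over K) 2 M ∧ IsSelfDualLattice σ ϖ ((StdForm.antidiagonal 3).over K) M' := by
  have hϖ0 : ϖ ≠ 0 := uniformizer_ne_zero hϖ
  obtain ⟨d, hdM⟩ := hM
  obtain ⟨d', hdM'⟩ := hM'
  rcases type_eq_zero_or_two_of_isVertexLattice_three hvσ hϖ v_det_antidiagonal_three hdM with rfl | rfl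
  · exact absurd h (not_lt_of_isSelfDualLattice hvσ isUnit_det_antidiagonal hdM ⟨d', hdM'⟩)
  · rcases type_eq_zero_or_two_of_isVertexLattice_three hvσ hϖ v_det_antidiagonal_three hdM' with rfl | rfl
    · exact ⟨hdM, hdM'⟩
    · exact absurd (eq_of_le_of_isVertexLattice hvσ hϖ0 hdM hdM' h.le) h.ne

/-- **A type-two vertex is not self-dual** (any `H`, `|ϖ| = exp(−1)`, `σ` valuation-preserving). [cite: Jacobowitz1962, §7–§8] -/
theorem not_isSelfDualLattice_of_isVertexLattice_two_of_v {N : ℕ} (hvσ : ∀ a, Valued.v (σ a) = Valued.v a) (hϖ : Valued.v ϖ = WithZero.exp (-1 : ℤ))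
    {M : Submodule 𝒪[K] (Fin N → K)} {H : Matrix (Fin N) (Fin N) K} (hM : IsVertexLattice σ ϖ H 2 M) : ¬ IsSelfDualLattice σ ϖ H M := by
  intro h0
  obtain ⟨g, rfl, -, -, hdet2⟩ := hM
  obtain ⟨-, -, hdet0⟩ := vertexTriple_of_latt_eq (ϖ := ϖ) hvσ h0
  rw [hdet0, pow_zero, hϖ, ← WithZero.exp_nsmul, ← WithZero.exp_zero, WithZero.exp_inj] at hdet2
  norm_num at hdet2

/-! ## §2 The star of a vertex, by type; types alternate (any involution) -/

/-- Adjacency at a self-dual vertex: `v ~ w ↔ w.1 < v.1` (no datum). [cite: BruhatTits1972, §10] -/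
theorem latticeGraph_adj_iff_lt_of_isSelfDualLattice_of_v (hvσ : ∀ a, Valued.v (σ a) = Valued.v a)
    {v w : {M : Submodule 𝒪[K] (Fin 3 → K) // IsVertex σ ϖ ((StdForm.antidiagonal 3).over K) M}} (hv : IsSelfDualLattice σ ϖ ((StdForm.antidiagonal 3).over K) v.1) : (latticeGraph σ ϖ ((StdForm.antidiagonal 3).over K)).Adj v w ↔ w.1 < v.1 := by
  rw [latticeGraph_adj_iff]
  constructor
  · rintro (h | h)
    · exact absurd h (not_lt_of_isSelfDualLattice hvσ isUnit_det_antidiagonal hv w.2)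
    · exact h
  · exact Or.inr

/-- Adjacency at a type-two vertex: `v ~ w ↔ v.1 < w.1` (no datum). [cite: BruhatTits1972, §10] -/
theorem latticeGraph_adj_iff_gt_of_isVertexLattice_two_of_v (hvσ : ∀ a, Valued.v (σ a) = Valued.v a) (hϖ : Valued.v ϖ = WithZero.exp (-1 : ℤ))
    {v w : {M : Submodule 𝒪[K] (Fin 3 → K) // IsVertex σ ϖ ((StdForm.antidiagonal 3).over K) M}} (hv : IsVertexLattice σ ϖ ((StdForm.antidiagonal 3).over K) 2 v.1) : (latticeGraph σ ϖ ((StdForm.antidiagonal 3).over K)).Adj v w ↔ v.1 < w.1 := by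
  rw [latticeGraph_adj_iff]
  constructor
  · rintro (h | h)
    · exact h
    · exact absurd (isVertexLattice_two_and_isSelfDualLattice_of_lt_of_v hvσ hϖ w.2 v.2 h).2 (not_isSelfDualLattice_of_isVertexLattice_two_of_v hvσ hϖ hv)
  · exact Or.inl

/-- The star of a self-dual vertex = the vertices strictly below it (no datum). [cite: Tits1979, §3.5] -/
theorem neighborSet_eq_of_isSelfDualLattice_of_v (hvσ : ∀ a, Valued.v (σ a) = Valued.v a)
    {v : {M : Submodule 𝒪[K] (Fin 3 → K) // IsVertex σ ϖ ((StdForm.antidiagonal 3).over K) M}} (hv : IsSelfDualLattice σ ϖ ((StdForm.antidiagonal 3).over K) v.1) : (latticeGraph σ ϖ ((StdForm.antidiagonal 3).over K)).neighborSet v = {w | w.1 < v.1} :=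
  Set.ext fun _ => latticeGraph_adj_iff_lt_of_isSelfDualLattice_of_v hvσ hv

/-- The star of a type-two vertex = the vertices strictly above it (no datum). [cite: Tits1979, §3.5] -/
theorem neighborSet_eq_of_isVertexLattice_two_of_v (hvσ : ∀ a, Valued.v (σ a) = Valued.v a) (hϖ : Valued.v ϖ = WithZero.exp (-1 : ℤ))
    {v : {M : Submodule 𝒪[K] (Fin 3 → K) // IsVertex σ ϖ ((StdForm.antidiagonal 3).over K) M}} (hv : IsVertexLattice σ ϖ ((StdForm.antidiagonal 3).over K) 2 v.1) : (latticeGraph σ ϖ ((StdForm.antidiagonal 3).over K)).neighborSet v = {w | v.1 < w.1} :=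
  Set.ext fun _ => latticeGraph_adj_iff_gt_of_isVertexLattice_two_of_v hvσ hϖ hv

/-- **Types alternate along edges** (no datum): for adjacent `v, w` exactly one is self-dual. [cite: BruhatTits1972, §10] [cite: Serre1980Trees, I.2.3] -/
theorem isSelfDualLattice_iff_not_isSelfDualLattice_of_adj_of_v (hvσ : ∀ a, Valued.v (σ a) = Valued.v a) (hϖ : Valued.v ϖ = WithZero.exp (-1 : ℤ))
    {v w : {M : Submodule 𝒪[K] (Fin 3 → K) // IsVertex σ ϖ ((StdForm.antidiagonal 3).over K) M}} (h : (latticeGraph σ ϖ ((StdForm.antidiagonal 3).over K)).Adj v w) : IsSelfDualLattice σ ϖ ((StdForm.antidiagonal 3).over K) v.1 ↔ ¬ IsSelfDualLattice σ ϖ ((StdForm.antidiagonal 3).over K) w.1 := by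
  obtain ⟨d, hdv⟩ := v.2
  rcases type_eq_zero_or_two_of_isVertexLattice_three hvσ hϖ v_det_antidiagonal_three hdv with rfl | rfl
  · refine ⟨fun hv => not_isSelfDualLattice_of_isVertexLattice_two_of_v hvσ hϖ ?_, fun _ => hdv⟩
    exact (isVertexLattice_two_and_isSelfDualLattice_of_lt_of_v hvσ hϖ w.2 v.2 ((latticeGraph_adj_iff_lt_of_isSelfDualLattice_of_v hvσ hv).1 h)).1
  · constructor
    · exact fun hv => absurd hv (not_isSelfDualLattice_of_isVertexLattice_two_of_v hvσ hϖ hdv)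
    · intro hw
      exact absurd (isVertexLattice_two_and_isSelfDualLattice_of_lt_of_v hvσ hϖ v.2 w.2 ((latticeGraph_adj_iff_gt_of_isVertexLattice_two_of_v hvσ hϖ hdv).1 h)).2 hw

/-! ## §3 Transport to the root `L₀ = 𝒪³` and to `N₁ = latt diag(1,1,ϖ)` (any involution) -/

/-- The root `𝒪³` is a self-dual vertex of `(K³, J₀)` for every `σ` and every `|ϖ| = exp(−1)`. [cite: BruhatTits1972, §10] -/
theorem isSelfDualLattice_stdLattice_three_of_v (hϖ : Valued.v ϖ = WithZero.exp (-1 : ℤ)) : IsSelfDualLattice σ ϖ ((StdForm.antidiagonal 3).over K) (stdLattice K 3) :=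
  isSelfDualLattice_stdLattice isIntMatrix_antidiagonal isIntMatrix_antidiagonal_inv v_det_antidiagonal_three (uniformizer_mem_integer hϖ)

/-- The root reaches every self-dual vertex under `U(σ, J₀)`, given a trace element (★ p07 `…_of_trace`; no datum, no sign on `σϖ`). [cite: BruhatTits1972, §10] -/
theorem exists_latticeGraphIso_root_eq_of_trace (hσ : ∀ x, σ (σ x) = x) (hvσ : ∀ a, Valued.v (σ a) = Valued.v a) (hϖ : Valued.v ϖ = WithZero.exp (-1 : ℤ))
    (htrace : ∃ t : K, Valued.v t ≤ 1 ∧ t + σ t = 1) (v : {M : Submodule 𝒪[K] (Fin 3 → K) // IsVertex σ ϖ ((StdForm.antidiagonal 3).over K) M}) (hv : IsSelfDualLattice σ ϖ ((StdForm.antidiagonal 3).over K) v.1) :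
    ∃ u : unitaryGroupOfForm σ ((StdForm.antidiagonal 3).over K), latticeGraphIso σ ϖ ((StdForm.antidiagonal 3).over K) u ⟨stdLattice K 3, 0, isSelfDualLattice_stdLattice_three_of_v hϖ⟩ = v := by
  obtain ⟨u, hu⟩ := exists_unitary_mapGL_stdLattice_eq_of_isSelfDualLattice_of_trace hσ hvσ hϖ htrace hv
  exact ⟨u, Subtype.ext (by rw [latticeGraphIso_apply_val]; exact hu)⟩

/-- `N₁` reaches every type-two vertex under `U(σ, J₀)`, given type-two transitivity `htr₂` as a hypothesis (★ for either sign of `σϖ`). [cite: BruhatTits1972, §10] -/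
theorem exists_latticeGraphIso_N₁_eq_of_htr₂ (hN₁ : IsVertexLattice σ ϖ ((StdForm.antidiagonal 3).over K) 2 (latt (Matrix.diagonal ![(1 : K), 1, ϖ])))
    (htr₂ : ∀ M : Submodule 𝒪[K] (Fin 3 → K), IsVertexLattice σ ϖ ((StdForm.antidiagonal 3).over K) 2 M → ∃ u : unitaryGroupOfForm σ ((StdForm.antidiagonal 3).over K), M = mapGL (u : GL (Fin 3) K) (latt (Matrix.diagonal ![(1 : K), 1, ϖ])))
    (v : {M : Submodule 𝒪[K] (Fin 3 → K) // IsVertex σ ϖ ((StdForm.antidiagonal 3).over K) M}) (hv : IsVertexLattice σ ϖ ((StdForm.antidiagonal 3).over K) 2 v.1) :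
    ∃ u : unitaryGroupOfForm σ ((StdForm.antidiagonal 3).over K), latticeGraphIso σ ϖ ((StdForm.antidiagonal 3).over K) u ⟨(latt (Matrix.diagonal ![(1 : K), 1, ϖ])), 2, hN₁⟩ = v := by
  obtain ⟨u, hu⟩ := htr₂ v.1 hv
  exact ⟨u, Subtype.ext (by rw [latticeGraphIso_apply_val]; exact hu.symm)⟩

/-- **The star of a self-dual vertex has the cardinality of the star of the root** (any involution with a trace element). [cite: BruhatTits1972, §10] [cite: Serre1980Trees, II.1.1] -/
theorem ncard_neighborSet_eq_ncard_neighborSet_root_of_trace (hσ : ∀ x, σ (σ x) = x) (hvσ : ∀ a, Valued.v (σ a) = Valued.v a) (hϖ : Valued.v ϖ = WithZero.exp (-1 : ℤ))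
    (htrace : ∃ t : K, Valued.v t ≤ 1 ∧ t + σ t = 1) (v : {M : Submodule 𝒪[K] (Fin 3 → K) // IsVertex σ ϖ ((StdForm.antidiagonal 3).over K) M}) (hv : IsSelfDualLattice σ ϖ ((StdForm.antidiagonal 3).over K) v.1) :
    ((latticeGraph σ ϖ ((StdForm.antidiagonal 3).over K)).neighborSet v).ncard = ((latticeGraph σ ϖ ((StdForm.antidiagonal 3).over K)).neighborSet ⟨stdLattice K 3, 0, isSelfDualLattice_stdLattice_three_of_v hϖ⟩).ncard := by
  obtain ⟨u, rfl⟩ := exists_latticeGraphIso_root_eq_of_trace hσ hvσ hϖ htrace v hv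
  exact ncard_neighborSet_latticeGraphIso u _

/-- Finiteness of the star of a self-dual vertex ↔ that of the root (any involution with a trace element). [cite: BruhatTits1972, §10] -/
theorem finite_neighborSet_iff_root_of_trace (hσ : ∀ x, σ (σ x) = x) (hvσ : ∀ a, Valued.v (σ a) = Valued.v a) (hϖ : Valued.v ϖ = WithZero.exp (-1 : ℤ))
    (htrace : ∃ t : K, Valued.v t ≤ 1 ∧ t + σ t = 1) (v : {M : Submodule 𝒪[K] (Fin 3 → K) // IsVertex σ ϖ ((StdForm.antidiagonal 3).over K) M}) (hv : IsSelfDualLattice σ ϖ ((StdForm.antidiagonal 3).over K) v.1) :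
    ((latticeGraph σ ϖ ((StdForm.antidiagonal 3).over K)).neighborSet v).Finite ↔ ((latticeGraph σ ϖ ((StdForm.antidiagonal 3).over K)).neighborSet ⟨stdLattice K 3, 0, isSelfDualLattice_stdLattice_three_of_v hϖ⟩).Finite := by
  obtain ⟨u, rfl⟩ := exists_latticeGraphIso_root_eq_of_trace hσ hvσ hϖ htrace v hv
  exact finite_neighborSet_latticeGraphIso_iff u _

/-- **The star of a type-two vertex has the cardinality of the star of `N₁`** (given `hN₁`, `htr₂`). [cite: BruhatTits1972, §10] [cite: Serre1980Trees, II.1.1] -/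
theorem ncard_neighborSet_eq_ncard_neighborSet_N₁_of_htr₂ (hN₁ : IsVertexLattice σ ϖ ((StdForm.antidiagonal 3).over K) 2 (latt (Matrix.diagonal ![(1 : K), 1, ϖ])))
    (htr₂ : ∀ M : Submodule 𝒪[K] (Fin 3 → K), IsVertexLattice σ ϖ ((StdForm.antidiagonal 3).over K) 2 M → ∃ u : unitaryGroupOfForm σ ((StdForm.antidiagonal 3).over K), M = mapGL (u : GL (Fin 3) K) (latt (Matrix.diagonal ![(1 : K), 1, ϖ])))
    (v : {M : Submodule 𝒪[K] (Fin 3 → K) // IsVertex σ ϖ ((StdForm.antidiagonal 3).over K) M}) (hv : IsVertexLattice σ ϖ ((StdForm.antidiagonal 3).over K) 2 v.1) :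
    ((latticeGraph σ ϖ ((StdForm.antidiagonal 3).over K)).neighborSet v).ncard = ((latticeGraph σ ϖ ((StdForm.antidiagonal 3).over K)).neighborSet ⟨(latt (Matrix.diagonal ![(1 : K), 1, ϖ])), 2, hN₁⟩).ncard := by
  obtain ⟨u, rfl⟩ := exists_latticeGraphIso_N₁_eq_of_htr₂ hN₁ htr₂ v hv
  exact ncard_neighborSet_latticeGraphIso u _

/-- Finiteness of the star of a type-two vertex ↔ that of `N₁` (given `hN₁`, `htr₂`). [cite: BruhatTits1972, §10] -/
theorem finite_neighborSet_iff_N₁_of_htr₂ (hN₁ : IsVertexLattice σ ϖ ((StdForm.antidiagonal 3).over K) 2 (latt (Matrix.diagonal ![(1 : K), 1, ϖ])))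
    (htr₂ : ∀ M : Submodule 𝒪[K] (Fin 3 → K), IsVertexLattice σ ϖ ((StdForm.antidiagonal 3).over K) 2 M → ∃ u : unitaryGroupOfForm σ ((StdForm.antidiagonal 3).over K), M = mapGL (u : GL (Fin 3) K) (latt (Matrix.diagonal ![(1 : K), 1, ϖ])))
    (v : {M : Submodule 𝒪[K] (Fin 3 → K) // IsVertex σ ϖ ((StdForm.antidiagonal 3).over K) M}) (hv : IsVertexLattice σ ϖ ((StdForm.antidiagonal 3).over K) 2 v.1) :
    ((latticeGraph σ ϖ ((StdForm.antidiagonal 3).over K)).neighborSet v).Finite ↔ ((latticeGraph σ ϖ ((StdForm.antidiagonal 3).over K)).neighborSet ⟨(latt (Matrix.diagonal ![(1 : K), 1, ϖ])), 2, hN₁⟩).Finite := by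
  obtain ⟨u, rfl⟩ := exists_latticeGraphIso_N₁_eq_of_htr₂ hN₁ htr₂ v hv
  exact finite_neighborSet_latticeGraphIso_iff u _

/-- The star of the root as a set of lattices: `w ∈ star(L₀) ↔ w.1 < 𝒪³` (no datum). [cite: Serre1980Trees, II.1.1] -/
theorem mem_neighborSet_root_iff_of_v (hvσ : ∀ a, Valued.v (σ a) = Valued.v a) (hϖ : Valued.v ϖ = WithZero.exp (-1 : ℤ)) (w : {M : Submodule 𝒪[K] (Fin 3 → K) // IsVertex σ ϖ ((StdForm.antidiagonal 3).over K) M}) :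
    w ∈ (latticeGraph σ ϖ ((StdForm.antidiagonal 3).over K)).neighborSet ⟨stdLattice K 3, 0, isSelfDualLattice_stdLattice_three_of_v hϖ⟩ ↔ w.1 < stdLattice K 3 :=
  latticeGraph_adj_iff_lt_of_isSelfDualLattice_of_v hvσ (isSelfDualLattice_stdLattice_three_of_v hϖ)

/-- The star of `N₁` as a set of lattices: `w ∈ star(N₁) ↔ N₁ < w.1` (given `hN₁`; no datum). [cite: Serre1980Trees, II.1.1] -/
theorem mem_neighborSet_N₁_iff_of_v (hvσ : ∀ a, Valued.v (σ a) = Valued.v a) (hϖ : Valued.v ϖ = WithZero.exp (-1 : ℤ)) (hN₁ : IsVertexLattice σ ϖ ((StdForm.antidiagonal 3).over K) 2 (latt (Matrix.diagonal ![(1 : K), 1, ϖ]))) (w : {M : Submodule 𝒪[K] (Fin 3 → K) // IsVertex σ ϖ ((StdForm.antidiagonal 3).over K) M}) :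
    w ∈ (latticeGraph σ ϖ ((StdForm.antidiagonal 3).over K)).neighborSet ⟨(latt (Matrix.diagonal ![(1 : K), 1, ϖ])), 2, hN₁⟩ ↔ (latt (Matrix.diagonal ![(1 : K), 1, ϖ])) < w.1 :=
  latticeGraph_adj_iff_gt_of_isVertexLattice_two_of_v hvσ hϖ hN₁

end Literature.NumberTheory.Automorphic.UnitaryLatticeTree

end
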